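import Summits.QuantumFields.YangMills.Theorems.UnitScaleTiltFluctuationComparisonRegPrGlobalSlackCanonicalPolymers
import Summits.QuantumFields.YangMills.Theorems.UnitScaleTiltFluctuationComparisonRegPrRepAtHeightsCoreV3Fam
import HarnessLib

/-!
# `UnitScaleTiltFluctuationComparisonRegPrGlobalSlackCanonicalPolymersCore` — THE CANONICAL POLYMERISATION OVER THE ROW-STABLE DATA CORE `PkgCoreV3`, AND (43) AT THE TRIVIAL HISTORY
# (crux `FluctuationComparisonRegPrIntL`, stmt-QuantumFields-20520, skeleton v5kC (OWNER C3, R-57χ): STUB 3⁗χ `stub_globalTwoRunSlackFamChi` and STUB (i*)χ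
# `stub_smallBlocksSlackOnChiAllChi`; width-lever lane B «(R1) print's χ of [Balaban1985UV3] (47) back», seat ym-ust-19935-r1 g4)

WHY.  Under the additive repair R-57χ (OWNER RULING g23-№2 ADD. 6) the (α) record exists twice — the old package `AlphaInputsT3AC.PkgAtV3` and the χ-package
`AlphaInputsT3AC.PkgAtV3Chi` (print's lower row (47) «χ·χ_k») — and both PROJECT to the row-stable data core `AlphaInputsT3AC.PkgCoreV3` (★alpha-1, `AlphaInputsT3ACv3Core`);
the v5kC stubs 3⁗χ / (i*)χ read the χ-record's datum `AlphaInputsT3AC.dataOfV3chi p π`, which IS `AlphaInputsT3AC.dataOfCoreV3 (fun K ↦ (p K).toCore) π` (★r1 g3,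
`…RepAtHeightsChiV3Fam`, an `abbrev`).  Lane A's canonical polymerisation `canonPolymer p` / `canonPT p` (seat ym-ust-19935-slack g0, `…GlobalSlackCanonicalPolymers`, p533541)
and its five producer rows are stated over `p : ∀ K, PkgAtV3 …` and therefore reach NEITHER χ-stub.  They read the package only through CORE fields (`𝔖`, `𝔄`, the AC
tower `T`, and the χ-free step rows `hPY`/`hPYZ`/`chart`/`bound28`/`far_le`/`h44`/`hfloor` of `AlphaV3AC.StepAlphaV3CoreAC`), so this file states them ONCE over the core:

* §1 `newDomsCore q`, `canonLocCore q`, `canonTreeLenCore q`, **`canonPolymerCore q`**, `newTermCore q`, `oldTermCore q`, **`canonPTCore q`** for a family of data cores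
  `q : ∀ K, PkgCoreV3 F 𝔠 γ hγ hγ1 K` — `…CanonicalPolymers` §2–§3 VERBATIM with `(p K).𝔖 ↦ (q K).𝔖` etc. (the point sets `blockSet`/`domSet` and the scales `SK` are lane A's,
  imported);
* §2 **`pintDecompTrivT_canonCore : PintDecompTrivT (dataOfCoreV3 q (canonPolymerCore q)) (canonPTCore q)`** — (43) at the trivial history for EVERY family of data cores
  (proof = p533541's with `run.steps ↦ runCore.steps`);
* §3 the old objects are the instances along `PkgAtV3.toCore`: `canonLoc_eq_core`, `canonTreeLen_eq_core`, `canonPolymer_eq_core`, `canonPT_eq_core` (definitional) — so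
  nothing proved for `canonPolymer p` is lost, and the χ-record's canonical polymerisation is `canonPolymerCore (fun K ↦ (p K).toCore)` for `p : ∀ K, PkgAtV3Chi …`.
The producer rows over the core (`…CanonicalPolymersCoreRows`, `…CoreSizes`) and the χ-capstones (`…CanonicalEndToEndChi`, `…CanonicalOnChiChi`) follow in sibling files.
DEFINITIONS + one bookkeeping identity; no estimate; nothing of [Balaban1985UV3] is asserted beyond the core's own rows.

References: T. Bałaban, CMP 102 (1985) 255–275 [Balaban1985UV3] ((24) p.262, (33) p.264, (43) p.266, (58)–(61) pp.270–271, p.272); CMP 109 (1987) 249–301 [Balaban1987RG1] ((0.1) p.251).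
-/

set_option autoImplicit false

noncomputable section

namespace Summit.QuantumFields.YangMills.Theorems.GlobalSlackCanonicalPolymers

open scoped BigOperators
open Finset
open Literature.MathematicalPhysics.QuantumFieldTheory.Balaban1983to89
open Literature.MathematicalPhysics.QuantumFieldTheory.Balaban1983to89.T3ContinuumYM3Torus
open Literature.MathematicalPhysics.QuantumFieldTheory.Balaban1983to89.T3AlphaInputsAC
open Literature.MathematicalPhysics.QuantumFieldTheory.Balaban1983to89.T3AlphaInputsACTwoRunLevel
open Literature.MathematicalPhysics.QuantumFieldTheory.Balaban1983to89.TreeLengthTorus (tsys)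
open Literature.MathematicalPhysics.QuantumFieldTheory.Balaban1985CMP102
open Literature.MathematicalPhysics.QuantumFieldTheory.Balaban1985CMP102.Setting
open Summit.QuantumFields.Balaban3D.Carriers
open Summit.QuantumFields.Balaban3D.Proofs.Primitives
open Summit.QuantumFields.Balaban3D.Proofs.Representation33 (jet26)
open Summit.QuantumFields.YangMills.Theorems

variable {F : T3Family} {𝔠 : AlphaConsts F.L (suGroupModel 2).N} {γ : ℝ} {hγ : 0 < γ} {hγ1 : γ ≤ (min 𝔠.gamma0 1) ^ 2}

variable (q : ∀ K, AlphaInputsT3AC.PkgCoreV3 F 𝔠 γ hγ hγ1 K)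

/-- The retained localisation domains of the new terms born at step `k` of run `K`, history `h` ((59): inside `Ω_{k+1}(h)`, tree length `< R₁r(g_k)`). [cite: Balaban1985UV3, (59) p.270] -/
abbrev newDomsCore (K k : ℕ) (h : Hist (F.P K) (k + 1)) : Finset (tsys 3 (nblkOf (SK F 𝔠 γ hγ hγ1 K) 𝔠.lane.carrier k)).Dom :=
  ((q K).𝔖 k).loc (ΩblkOf 𝔠.lane.carrier.M₁ (rcolOf (SK F 𝔠 γ hγ hγ1 K) 𝔠.lane.carrier) (nblkOf (SK F 𝔠 γ hγ hγ1 K) 𝔠.lane.carrier k))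
    (rretOf (SK F 𝔠 γ hγ hγ1 K) 𝔠.lane.carrier k) h

/-! ## §1 The canonical polymerisation and term function of a family of data cores -/

open Classical in
/-- THE LOCALISATION DOMAINS OF THE CANONICAL POLYMERISATION of run `K` at lattice level `j`, history `h`, term level `i`: no terms at level `0`; at level `k+1`,
the new terms (`i = k+1`) in the point sets of the retained domains, the old terms (`1 ≤ i ≤ k`) block by block; above the top (`K < k+1`, where the package
has no step rows and no socket row reads) ONE dummy domain (the whole torus) at term level `1`, so that the volume row holds there too. [cite: Balaban1985UV3, (43) p.266, (59) p.270] -/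
def canonLocCore (K j : ℕ) (h : Hist (F.P K) j) (i : ℕ) : Finset (Set (Site (F.P K) 0)) :=
  match j, h with
  | 0, _ => ∅
  | k + 1, h =>
    if k + 1 ≤ K then
      (if i = k + 1 then (newDomsCore q K k h).image (domSet (F := F) 𝔠.lane.carrier.M₁ K k)
       else if i ∈ Finset.Icc 1 k then
         (oldBlocks 𝔠.lane.carrier.M₁ (rcolOf (SK F 𝔠 γ hγ hγ1 K) 𝔠.lane.carrier) h i).image (blockSet K i)
       else ∅)
    else (if i = 1 then {Set.univ} else ∅)

open Classical in
/-- THE TREE LENGTH of a point set at term level `i` of run `K`: the infimum of `tsys.dj` over the step-`(i−1)` domains with that point set (`0` if there is none —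
block domains). [cite: Balaban1985UV3, (24)–(25) p.262, (59) p.270] -/
def canonTreeLenCore (K i : ℕ) (Y : Set (Site (F.P K) 0)) : ℝ :=
  sInf ((fun X => (tsys 3 ((q K).𝔖 (i - 1)).Nblk).dj X) ''
    {X : (tsys 3 ((q K).𝔖 (i - 1)).Nblk).Dom | domSet (F := F) 𝔠.lane.carrier.M₁ K (i - 1) X = Y})

/-- **THE CANONICAL POLYMERISATION OF THE FAMILY OF DATA CORES `q`** as a polymer parameter of the interface: `Loc := canonLocCore`, `treeLen := canonTreeLenCore`; the fine-field term
`Pterm` and the enlargement `enl` are PLACEHOLDERS (`0`, `id`) — the coarse-field T-socket of 3⁗ (`PintDecompTrivT`/`TermSizeTrivT`/`PolymerCauchyMinAtT…`) never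
reads them. [cite: Balaban1985UV3, (43) p.266] -/
def canonPolymerCore : AlphaInputsT3AC.PolymerT3 F where
  Loc := canonLocCore q
  Pterm := fun _ _ _ _ => 0
  enl := fun _ _ Y => Y
  treeLen := canonTreeLenCore q



/-- THE NEW TERM OF A RETAINED DOMAIN at the trivial history: `Re jet26(Ψ_X)(B_X(triv, W)) − far_X(triv, W)` for the step charts AND the G3D-07 charts `Λc`
(the summands of `hPY` and `hPYZ`). [cite: Balaban1985UV3, (33) p.264, (60)–(61) p.271] -/
def newTermCore (K k : ℕ) (X : (tsys 3 (nblkOf (SK F 𝔠 γ hγ hγ1 K) 𝔠.lane.carrier k)).Dom)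
    (W : GaugeField (F.P K) (k + 1) (Matrix.specialUnitaryGroup (Fin 2) ℂ)) : ℝ :=
  ((jet26 (((q K).𝔖 k).Ψ X) (((q K).𝔖 k).Bcfg X (Hist.triv (F.P K) (k + 1)) W)).re - ((q K).𝔖 k).far X (Hist.triv (F.P K) (k + 1)) W) +
  ((jet26 (((q K).𝔄.Λc k).Ψ X) (((q K).𝔖 k).Bcfg X (Hist.triv (F.P K) (k + 1)) W)).re - ((q K).𝔄.Λc k).far X (Hist.triv (F.P K) (k + 1)) W)

/-- THE OLD TERM OF A BLOCK at the trivial history: the lane's `oldVal` of level `i`, block `y`, summed over degrees `n ≤ Ndeg i` and bond tuples in the collar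
(`Carriers.oldSumIn`'s summand; nothing is dropped at the trivial history). [cite: Balaban1985UV3, (43) p.266, (58) p.270] -/
def oldTermCore (K k i : ℕ) (y : Site (F.P K) i) (W : GaugeField (F.P K) (k + 1) (Matrix.specialUnitaryGroup (Fin 2) ℂ)) : ℝ :=
  ∑ n ∈ range (((q K).𝔖 k).Ndeg i + 1),
    ∑ c ∈ Fintype.piFinset (fun _ : Fin n => oldBonds 𝔠.lane.carrier.M₁ (rcolOf (SK F 𝔠 γ hγ hγ1 K) 𝔠.lane.carrier) (Hist.triv (F.P K) (k + 1)) i y),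
      (if Drop 𝔠.lane.carrier.M₁ (rcolOf (SK F 𝔠 γ hγ hγ1 K) 𝔠.lane.carrier) (Hist.triv (F.P K) (k + 1)) i y n c then 0
       else ((q K).𝔖 k).oldVal (Hist.triv (F.P K) (k + 1)) W i y n c)

open Classical in
/-- **THE CANONICAL TERM FUNCTION OF THE FAMILY OF DATA CORES `q`** (coarse-field-indexed, trivial history): at lattice level `k+1` of run `K`, the level-`(k+1)` term of a point set
`Y` is the sum of the new terms of the retained domains with point set `Y`, the level-`i ≤ k` term of `Y` is the sum of the old terms of the blocks with point set
`Y`; above the top the whole `Pint` sits on the dummy domain at term level `1`. [cite: Balaban1985UV3, (43) p.266] -/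
def canonPTCore : TermFn F := fun K j i Y W =>
  match j, W with
  | 0, _ => 0
  | k + 1, W =>
    if k + 1 ≤ K then
      (if i = k + 1 then
         ∑ X ∈ (newDomsCore q K k (Hist.triv (F.P K) (k + 1))).filter (fun X => domSet (F := F) 𝔠.lane.carrier.M₁ K k X = Y), newTermCore q K k X W
       else
         ∑ y ∈ (oldBlocks 𝔠.lane.carrier.M₁ (rcolOf (SK F 𝔠 γ hγ hγ1 K) 𝔠.lane.carrier) (Hist.triv (F.P K) (k + 1)) i).filter
           (fun y => blockSet K i y = Y), oldTermCore q K k i y W)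
    else (if i = 1 then (q K).T.Pint (k + 1) (Hist.triv (F.P K) (k + 1)) W else 0)

/-! ## §2 (43) at the trivial history for the canonical polymerisation of a family of data cores — a theorem -/

/-- `Pint` of the package's tower at level `k+1` IS `PoldIn_k + PY_k + PYZ_k` (`Carriers.pintOfSeries`, definitional). [cite: Balaban1985UV3, (43) p.266] -/
theorem pint_succ_eq_core (K k : ℕ) (h : Hist (F.P K) (k + 1)) (U : GaugeField (F.P K) (k + 1) (Matrix.specialUnitaryGroup (Fin 2) ℂ)) :
    (q K).T.Pint (k + 1) h U =
      ((q K).𝔖 k).PoldIn 𝔠.lane.carrier.M₁ (rcolOf (SK F 𝔠 γ hγ hγ1 K) 𝔠.lane.carrier) h U + ((q K).𝔖 k).PY h U + ((q K).𝔖 k).PYZ h U :=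
  rfl

/-- `Pint` of the package's tower at level `0` vanishes (definitional). [cite: Balaban1985UV3, (1) p.256] -/
theorem pint_zero_eq_core (K : ℕ) (h : Hist (F.P K) 0) (U : GaugeField (F.P K) 0 (Matrix.specialUnitaryGroup (Fin 2) ℂ)) :
    (q K).T.Pint 0 h U = 0 :=
  rfl

open Classical in
/-- The old slice regrouped by blocks: `PoldIn_k(triv, W) = Σ_{i=1}^{k} Σ_{Y ∈ canonLocCore (k+1) triv i} canonPTCore (k+1) i Y W`. [cite: Balaban1985UV3, (43) p.266, (58) p.270] -/
theorem poldIn_triv_eq_sum_core (K k : ℕ) (hk : k + 1 ≤ K) (W : GaugeField (F.P K) (k + 1) (Matrix.specialUnitaryGroup (Fin 2) ℂ)) :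
    ((q K).𝔖 k).PoldIn 𝔠.lane.carrier.M₁ (rcolOf (SK F 𝔠 γ hγ hγ1 K) 𝔠.lane.carrier) (Hist.triv (F.P K) (k + 1)) W =
      ∑ i ∈ Icc 1 k, ∑ Y ∈ canonLocCore q K (k + 1) (Hist.triv (F.P K) (k + 1)) i, canonPTCore q K (k + 1) i Y W := by
  unfold StepSeries.PoldIn oldSumIn
  refine Finset.sum_congr rfl fun i hi => ?_
  have hik : i ≠ k + 1 := by have := (Finset.mem_Icc.mp hi).2; omega
  have hloc : canonLocCore q K (k + 1) (Hist.triv (F.P K) (k + 1)) i =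
      (oldBlocks 𝔠.lane.carrier.M₁ (rcolOf (SK F 𝔠 γ hγ hγ1 K) 𝔠.lane.carrier) (Hist.triv (F.P K) (k + 1)) i).image (blockSet K i) := by
    simp only [canonLocCore, if_pos hk, if_neg hik, if_pos hi]
  have hPT : ∀ Y, canonPTCore q K (k + 1) i Y W =
      ∑ y' ∈ (oldBlocks 𝔠.lane.carrier.M₁ (rcolOf (SK F 𝔠 γ hγ hγ1 K) 𝔠.lane.carrier) (Hist.triv (F.P K) (k + 1)) i).filter
        (fun y' => blockSet K i y' = Y), oldTermCore q K k i y' W := fun Y => by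
    simp only [canonPTCore, if_pos hk, if_neg hik]
  rw [hloc, Finset.sum_image' (fun y => oldTermCore q K k i y W) (fun y _ => hPT (blockSet K i y))]
  rfl

open Classical in
/-- The new slice regrouped by point sets, `k < K`: `PY_k + PYZ_k = Σ_{Y ∈ canonLocCore (k+1) triv (k+1)} canonPTCore (k+1) (k+1) Y W` — the displayed identifications
`hPY`/`hPYZ` of the step rows and fibrewise re-indexing. [cite: Balaban1985UV3, (33) p.264, (59)–(61) pp.270–271] -/
theorem new_triv_eq_sum_core (K k : ℕ) (hk : k + 1 ≤ K) (W : GaugeField (F.P K) (k + 1) (Matrix.specialUnitaryGroup (Fin 2) ℂ)) :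
    ((q K).𝔖 k).PY (Hist.triv (F.P K) (k + 1)) W + ((q K).𝔖 k).PYZ (Hist.triv (F.P K) (k + 1)) W =
      ∑ Y ∈ canonLocCore q K (k + 1) (Hist.triv (F.P K) (k + 1)) (k + 1), canonPTCore q K (k + 1) (k + 1) Y W := by
  have hloc : canonLocCore q K (k + 1) (Hist.triv (F.P K) (k + 1)) (k + 1) =
      (newDomsCore q K k (Hist.triv (F.P K) (k + 1))).image (domSet (F := F) 𝔠.lane.carrier.M₁ K k) := by
    simp only [canonLocCore, if_pos hk, ite_true]
  have hPT : ∀ Y, canonPTCore q K (k + 1) (k + 1) Y W =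
      ∑ X' ∈ (newDomsCore q K k (Hist.triv (F.P K) (k + 1))).filter (fun X' => domSet (F := F) 𝔠.lane.carrier.M₁ K k X' = Y),
        newTermCore q K k X' W := fun Y => by
    simp only [canonPTCore, if_pos hk, ite_true]
  have hre : ∑ Y ∈ (newDomsCore q K k (Hist.triv (F.P K) (k + 1))).image (domSet (F := F) 𝔠.lane.carrier.M₁ K k),
      canonPTCore q K (k + 1) (k + 1) Y W = ∑ X ∈ newDomsCore q K k (Hist.triv (F.P K) (k + 1)), newTermCore q K k X W :=
    Finset.sum_image' (fun X => newTermCore q K k X W) (fun X _ => hPT (domSet (F := F) 𝔠.lane.carrier.M₁ K k X))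
  have h1 := ((q K).runCore.steps k hk).hPY (Hist.triv (F.P K) (k + 1)) W
  have h2 := ((q K).runCore.steps k hk).hPYZ (Hist.triv (F.P K) (k + 1)) W
  rw [hloc, hre, h1, h2, ← Finset.sum_add_distrib]
  exact Finset.sum_congr rfl fun X _ => rfl

open Classical in
/-- **(43) AT THE TRIVIAL HISTORY FOR THE CANONICAL POLYMERISATION — A THEOREM FOR EVERY FAMILY OF DATA CORES**: `PintDecompTrivT (dataOfCoreV3 q (canonPolymerCore q)) (canonPTCore q)`,
i.e. `Pint K j triv W = Σ_{i=1}^{j} Σ_{Y ∈ Loc K j triv i} canonPTCore K j i Y W` for every run, level and field — the producer's first row, discharged.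
[cite: Balaban1985UV3, (43) p.266, (58)–(61) pp.270–271] -/
theorem pintDecompTrivT_canonCore : PintDecompTrivT (AlphaInputsT3AC.dataOfCoreV3 q (canonPolymerCore q)) (canonPTCore q) := by
  intro K j W
  show (q K).T.Pint j (Hist.triv (F.P K) j) W = ∑ i ∈ Icc 1 j, ∑ Y ∈ canonLocCore q K j (Hist.triv (F.P K) j) i, canonPTCore q K j i Y W
  cases j with
  | zero => simp [pint_zero_eq_core]
  | succ k =>
    by_cases hk : k + 1 ≤ K
    · rw [pint_succ_eq_core, Finset.sum_Icc_succ_top (by omega : 1 ≤ k + 1), ← poldIn_triv_eq_sum_core q K k hk, add_assoc,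
        new_triv_eq_sum_core q K k hk W]
    · -- above the top: the whole `Pint` on the dummy domain at term level `1`
      rw [Finset.sum_eq_single_of_mem 1 (Finset.mem_Icc.mpr ⟨le_rfl, by omega⟩) (fun i _ hi1 => by
        simp only [canonLocCore, if_neg hk, if_neg hi1, Finset.sum_empty])]
      simp only [canonLocCore, canonPTCore, if_neg hk, ite_true, Finset.sum_singleton]


/-! ## §3 The old objects are the instances along `PkgAtV3.toCore` -/

section Compat

variable (p : ∀ K, AlphaInputsT3AC.PkgAtV3 F 𝔠 γ hγ hγ1 K)

/-- `newDoms p = newDomsCore (toCore ∘ p)` (definitional: `toCore` keeps `𝔖`). [folklore] -/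
theorem newDoms_eq_core (K k : ℕ) (h : Hist (F.P K) (k + 1)) : newDoms p K k h = newDomsCore (fun K => (p K).toCore) K k h := rfl

/-- `canonLoc p = canonLocCore (toCore ∘ p)` (definitional). [folklore] -/
theorem canonLoc_eq_core : canonLoc p = canonLocCore (fun K => (p K).toCore) := by
  funext K j h i
  cases j with
  | zero => rfl
  | succ k => rfl

/-- `canonTreeLen p = canonTreeLenCore (toCore ∘ p)` (definitional). [folklore] -/
theorem canonTreeLen_eq_core : canonTreeLen p = canonTreeLenCore (fun K => (p K).toCore) := rfl

/-- **`canonPolymer p = canonPolymerCore (toCore ∘ p)`** — lane A's canonical polymerisation of a v3 family IS the core one of the projected family. [folklore] -/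
theorem canonPolymer_eq_core : canonPolymer p = canonPolymerCore (fun K => (p K).toCore) := by
  rw [canonPolymer, canonPolymerCore, canonLoc_eq_core, canonTreeLen_eq_core]

/-- `newTerm p = newTermCore (toCore ∘ p)` (definitional). [folklore] -/
theorem newTerm_eq_core : newTerm p = newTermCore (fun K => (p K).toCore) := rfl

/-- `oldTerm p = oldTermCore (toCore ∘ p)` (definitional). [folklore] -/
theorem oldTerm_eq_core : oldTerm p = oldTermCore (fun K => (p K).toCore) := rfl

/-- **`canonPT p = canonPTCore (toCore ∘ p)`** — lane A's canonical term function IS the core one of the projected family. [folklore] -/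
theorem canonPT_eq_core : canonPT p = canonPTCore (fun K => (p K).toCore) := by
  funext K j i Y W
  cases j with
  | zero => rfl
  | succ k => rfl

end Compat

end Summit.QuantumFields.YangMills.Theorems.GlobalSlackCanonicalPolymers

end
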